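import Summits.QuantumFields.YangMills.Theorems.BalabanUVNodesN19NoLinearPriceWitness
import Literature.MathematicalPhysics.QuantumFieldTheory.Balaban1983to89.T4GenFunBounds
import Literature.Analysis.ODE.OneSidedComparison

/-!
# YM-DAG node N19 (= NE7 proper) — THE PRICE OF THE EXPECTATION CURRENCY IS INTRINSICALLY SUPER-LINEAR, II: the exponential-sum
# witness, the two laws on `[0, 1]`, and NO LINEAR PRICE

Cell `pub-ymgap`, HUMAN RULING D-0062 (Track A), R141 (C) wider-strategy seat `pub-ymgap-dag-n19-e` (strategy s3 = ALTERNATIVE CURRENCY),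
generation g10, second module (sibling of `…Theorems.BalabanUVNodesN19NoLinearPriceWitness`, filed right before; 400-line rule).  Route
`Summits/QuantumFields/YangMills/Theses/BalabanUVNodes.lean` rev 19, cluster item K3⁗ «SpineGivenEndpointR13Sep» (stmt-QuantumFields-20292); filed
`--supports` that item `--as helper` (it proves no registered stub).  COUNT-NEUTRAL: elementary probability over Mathlib (`Measure.dirac`, finite sums
of measures, `ProbabilityTheory.mgf ∕ cgf`) + the sibling's Chebyshev bookkeeping + the tree's `T4GenFunBounds.exp_neg_le_mgf_of_abs_le` BY NAME;
no scheme object, no Theses import; NOT a discharge claim.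

THE RESULT.  The seat's expectation currency (g4 ∕ g5: p477102 · p477267 · p480837 · p481156 · p482030) turns the currency of N19's DECL target —
`T4CauchySum.MatchingModConstants` ∕ `Spine.NE7.Target`: logarithms of dressed partition functions, i.e. CGF's, `ε`-close on a real window
`|t| ≤ l₀` — into closeness of MEANS at the linear-log price `4e^{1+l₀B}·ε·(1 + log⁺ ε⁻¹)∕l₀` (p480837
`…ExpectationCurrencyTwoConstants.abs_integral_sub_integral_le_linlog_of_cgf_close`).  Here the converse direction is settled: THE LOGARITHM IS
NOT AN ARTEFACT.  For every window and every odd `M` two probability laws on `[0, 1]` are exhibited (§5–§6) whose mgf's are `ε`-close on the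
window, `2(1 + 4M∕l₀)^{−M} ≤ ε ≤ 4·(l₀e^{l₀}∕(2M))^M`, and whose means differ by EXACTLY `ε∕(e^{l₀∕M} − 1) ≥ (M·e^{−l₀}∕l₀)·ε`
(★★ `exists_mgf_close_means_far`; cgf form `exists_cgf_close_means_far` with `e^{l₀}ε`); hence ★ `no_linear_price_mgf` ∕ ★ `no_linear_price_cgf`:
for every `C` a pair with generating functions `ε`-close on the window and `|E_ν − E_μ| > C·ε`.  The third module `…NoLinearPriceSharp` draws the
quantitative consequence (`log ε⁻¹ ≤ M·log(1 + 4M∕l₀)` along the family ⇒ the exponent `1` of the logarithm cannot be lowered to any `a < 1`).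

THE WITNESS (§3–§4, weights; §5, laws).  `w_j := (2∕Λ)·[uʲ] T_M((u − 1)∕r)`, `r = e^{l₀∕M} − 1`, `Λ = ∑_j |[uʲ]T_M((u−1)∕r)|` (sibling:
`2^{M−1}r^{−M} ≤ Λ ≤ (1+4∕r)^M`, mass `0` for odd `M`, first moment `±M∕r`); `∑_j w_j e^{tj∕M} = (2∕Λ)·T_M((e^{t∕M} − 1)∕r)` with
`|(e^{t∕M} − 1)∕r| ≤ 1` on the window (§3 `abs_expm1_ratio_le_one`; `e^a − 1 ≤ a·e^a` is the tree's `Literature.Analysis.ODE.exp_sub_one_le_mul_exp`) — ★★ `exists_expsum_witness`.  §5 realises any `w` with `∑ w = 0`, `∑|w| = 2`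
as `ν − μ`, `ν = ∑ ((|w_j| + w_j)∕2)·δ_{j∕M}`, `μ = ∑ ((|w_j| − w_j)∕2)·δ_{j∕M}`, both probability laws on the grid `{j∕M} ⊂ [0,1]`
(`exists_lawPair_of_weights`: `∫ g dν − ∫ g dμ = ∑ w_j g(j∕M)` for EVERY `g`).

HONEST FRAMING (binding).  Elementary and [folklore] in content; NO consumer in the DAG today (the apex consumes existence of limits, not rates —
`T4ApexHybrid` :112–:131); the value is an OPTIMALITY certificate for the lineage's rate theorems (p481156 ∕ p482030: the rates
`δ_K(1+log⁺δ_K⁻¹)` ∕ `τ_K(1+log⁺τ_K⁻¹)` cannot be made linear by ANY argument that uses only generating-function closeness on the window) and the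
typed statement that «matching mod constants on a window» is a STRICTLY WEAKER currency than «matching of expectations at the same rate».  Nothing
of Bałaban's is instantiated; NE7 ∕ NE7b ∕ NE7c NOT PRINTED, NOT proved; N19 NOT discharged; count-neutral.  One finite `T⁴` programme at fixed `ε`;
nothing continuum ∕ `ℝ⁴` ∕ OS ∕ mass-gap ∕ Clay.
-/

noncomputable section

open Polynomial Real Finset MeasureTheory ProbabilityTheory

namespace Summit.QuantumFields.YangMills.Theorems.BalabanUVNodesN19NoLinearPrice

open Summit.QuantumFields.YangMills.Theorems.BalabanUVNodesN19NoLinearPriceWitness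

/-! ## §3 Exponential sums on the grid `{j∕M}` -/

/-- The substitution `s(t) = (e^{t∕M} − 1)∕(e^{l₀∕M} − 1)` maps `|t| ≤ l₀` into `[−1, 1]` (upper end attained at
`t = l₀`; the lower bound is `e^{−a} − 1 ≥ −a ≥ 1 − e^{a}`, `a = l₀∕M`). [folklore] -/
theorem abs_expm1_ratio_le_one {l₀ : ℝ} (hl₀ : 0 < l₀) {M : ℕ} (hM : 0 < M) {t : ℝ} (ht : |t| ≤ l₀) :
    |(exp (l₀ / M) - 1)⁻¹ * (exp (t / M) - 1)| ≤ 1 := by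
  have hMr : (0 : ℝ) < M := Nat.cast_pos.mpr hM
  have ha0 : 0 < l₀ / M := div_pos hl₀ hMr
  have hr : 0 < exp (l₀ / M) - 1 := by
    have := Real.add_one_lt_exp ha0.ne'
    linarith
  obtain ⟨ht1, ht2⟩ := abs_le.mp ht
  rw [abs_le, le_inv_mul_iff₀ hr, inv_mul_le_iff₀ hr, mul_neg_one, mul_one]
  constructor
  · have h1 := Real.add_one_le_exp (l₀ / M)
    have h2 := Real.add_one_le_exp (t / M)
    have h3 : -l₀ / M ≤ t / M := div_le_div_of_nonneg_right (by linarith) hMr.le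
    rw [neg_div] at h3
    linarith
  · exact sub_le_sub_right (exp_le_exp.mpr (div_le_div_of_nonneg_right ht2 hMr.le)) 1

/-- An exponential sum on the grid `{j∕M}` with coefficient vector `[uʲ]p` is `p(e^{t∕M})`. [folklore] -/
theorem expsum_eq_eval (p : ℝ[X]) {D : ℕ} (hp : p.natDegree < D) (M : ℕ) (t : ℝ) :
    ∑ j ∈ range D, p.coeff j * exp (t * j / M) = p.eval (exp (t / M)) := by
  rw [eval_eq_sum_range' hp]
  refine sum_congr rfl fun j _ => ?_
  rw [← Real.exp_nat_mul]
  congr 2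
  ring

/-! ## §4 THE WITNESS -/

/-- **THE CHEBYSHEV EXPONENTIAL-SUM WITNESS.**  For every window `0 < l₀` and every odd `M`: a real weight vector `w` on
`{0, …, M}` and `ε > 0` with `∑ w_j = 0`, `∑ |w_j| = 2`, `2·(1 + 4M∕l₀)^{−M} ≤ ε ≤ 4·(l₀e^{l₀}∕(2M))^M`, the exponential sum
`t ↦ ∑_j w_j e^{t·j∕M}` bounded by `ε` on `|t| ≤ l₀` and EQUAL to `ε` at `t = l₀`, and first moment `∑_j w_j·(j∕M)` of modulus
EXACTLY `ε∕(e^{l₀∕M} − 1) ≥ (M·e^{−l₀}∕l₀)·ε`.  Weights `w_j = (2∕Λ)·[uʲ] T_M((u − 1)∕r)`, `r = e^{l₀∕M} − 1` (see the header).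
[folklore: Chebyshev ∕ Markov–Bernstein extremality at the centre of an interval, transported to exponential sums on a grid] -/
theorem exists_expsum_witness {l₀ : ℝ} (hl₀ : 0 < l₀) {M : ℕ} (hM : Odd M) :
    ∃ (w : ℕ → ℝ) (ε : ℝ), 0 < ε ∧ (∀ j, M < j → w j = 0) ∧
      ∑ j ∈ range (M + 1), w j = 0 ∧ ∑ j ∈ range (M + 1), |w j| = 2 ∧
      2 / (1 + 4 * M / l₀) ^ M ≤ ε ∧ ε ≤ 4 * (l₀ * exp l₀ / (2 * M)) ^ M ∧
      (∀ t : ℝ, |t| ≤ l₀ → |∑ j ∈ range (M + 1), w j * exp (t * j / M)| ≤ ε) ∧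
      ∑ j ∈ range (M + 1), w j * exp (l₀ * j / M) = ε ∧
      |∑ j ∈ range (M + 1), w j * (j / M)| = ε / (exp (l₀ / M) - 1) ∧
      M * exp (-l₀) / l₀ * ε ≤ |∑ j ∈ range (M + 1), w j * (j / M)| := by
  have hM0 : 0 < M := hM.pos
  have hMr : (0 : ℝ) < M := Nat.cast_pos.mpr hM0
  have hM1 : (1 : ℝ) ≤ M := by exact_mod_cast hM0
  -- the grid step `a = l₀/M` and the radius `r = e^{a} − 1`, `a ≤ r ≤ a·e^{a} ≤ l₀e^{l₀}/M`
  have ha0 : 0 < l₀ / M := div_pos hl₀ hMr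
  set r : ℝ := exp (l₀ / M) - 1 with hr_def
  have hra : l₀ / M ≤ r := by
    have := Real.add_one_le_exp (l₀ / M)
    rw [hr_def]
    linarith
  have hr0 : 0 < r := lt_of_lt_of_le ha0 hra
  have hal : l₀ / M ≤ l₀ := div_le_self hl₀.le hM1
  have hr_le : r ≤ l₀ * exp l₀ / M := by
    calc r ≤ l₀ / M * exp (l₀ / M) := Literature.Analysis.ODE.exp_sub_one_le_mul_exp _
      _ ≤ l₀ / M * exp l₀ := mul_le_mul_of_nonneg_left (exp_le_exp.mpr hal) ha0.le
      _ = l₀ * exp l₀ / M := by ring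
  have hinv_r : M * exp (-l₀) / l₀ ≤ r⁻¹ := by
    rw [le_inv_comm₀ (by positivity) hr0]
    calc r ≤ l₀ * exp l₀ / M := hr_le
      _ = (M * exp (-l₀) / l₀)⁻¹ := by
          rw [Real.exp_neg]
          field_simp
  -- the polynomial and its `ℓ¹`-sum
  set P : ℝ[X] := (Chebyshev.T ℝ M).comp (C r⁻¹ * (X - C 1)) with hP
  have hPdeg : P.natDegree < M + 1 := by
    rw [hP, natDegree_chebAff hr0.ne']
    exact Nat.lt_succ_self M
  set Λ : ℝ := ∑ j ∈ range (M + 1), |P.coeff j| with hΛ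
  have hΛlo : 2 ^ (M - 1) * r⁻¹ ^ M ≤ Λ := pow_le_sum_abs_coeff_chebAff hr0 M
  have hΛhi : Λ ≤ (1 + 4 / r) ^ M := sum_abs_coeff_chebAff_le hr0 M M le_rfl
  have hlead : 0 < (2 : ℝ) ^ (M - 1) * r⁻¹ ^ M := by positivity
  have hΛ0 : 0 < Λ := lt_of_lt_of_le hlead hΛlo
  have hc0 : 0 < 2 / Λ := by positivity
  -- the factorisations of the three sums through `P`
  have hsum : ∀ g : ℕ → ℝ, ∑ j ∈ range (M + 1), 2 / Λ * P.coeff j * g j =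
      2 / Λ * ∑ j ∈ range (M + 1), P.coeff j * g j := by
    intro g
    rw [mul_sum]
    exact sum_congr rfl fun j _ => mul_assoc _ _ _
  have hmom : ∑ j ∈ range (M + 1), 2 / Λ * P.coeff j * ((j : ℝ) / M) =
      2 / Λ / M * ∑ j ∈ range (M + 1), P.coeff j * j := by
    rw [mul_sum]
    exact sum_congr rfl fun j _ => by ring
  have habs_mom : |∑ j ∈ range (M + 1), 2 / Λ * P.coeff j * ((j : ℝ) / M)| = 2 / Λ / r := by
    rw [hmom, abs_mul, abs_of_pos (by positivity), hP, abs_sum_coeff_mul_chebAff hr0 hM]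
    field_simp
  refine ⟨fun j => 2 / Λ * P.coeff j, 2 / Λ, hc0, ?_, ?_, ?_, ?_, ?_, ?_, ?_, ?_, ?_⟩
  · -- support
    intro j hj
    show 2 / Λ * P.coeff j = 0
    rw [coeff_eq_zero_of_natDegree_lt (by rw [hP, natDegree_chebAff hr0.ne']; exact hj), mul_zero]
  · -- equal mass
    rw [← mul_sum, hP, sum_coeff_chebAff_eq_zero hr0.ne' hM, mul_zero]
  · -- total variation `2`
    have : ∀ j, |2 / Λ * P.coeff j| = 2 / Λ * |P.coeff j| := fun j => by
      rw [abs_mul, abs_of_pos hc0]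
    simp_rw [this]
    rw [← mul_sum, ← hΛ, div_mul_cancel₀ _ hΛ0.ne']
  · -- `ε` from below
    rw [div_le_div_iff_of_pos_left two_pos (by positivity) hΛ0]
    refine hΛhi.trans (pow_le_pow_left₀ (by positivity) ?_ M)
    have h4 : 4 / r ≤ 4 * M / l₀ := by
      rw [mul_div_assoc, div_eq_mul_inv 4 r]
      refine mul_le_mul_of_nonneg_left ?_ (by norm_num)
      calc r⁻¹ ≤ (l₀ / M)⁻¹ := by rw [inv_le_inv₀ hr0 ha0]; exact hra
        _ = M / l₀ := by rw [inv_div]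
    linarith
  · -- `ε` from above
    calc 2 / Λ ≤ 2 / (2 ^ (M - 1) * r⁻¹ ^ M) := div_le_div_of_nonneg_left zero_le_two hlead hΛlo
      _ = 4 * (r / 2) ^ M := by
          obtain ⟨k, rfl⟩ := Nat.exists_eq_add_of_le' hM0
          rw [Nat.add_sub_cancel, div_pow, inv_pow, pow_succ (2 : ℝ) k]
          field_simp
          ring
      _ ≤ 4 * (l₀ * exp l₀ / (2 * M)) ^ M := by
          gcongr 4 * ?_ ^ M
          calc r / 2 ≤ l₀ * exp l₀ / M / 2 := by gcongr
            _ = l₀ * exp l₀ / (2 * M) := by ring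
  · -- the window bound
    intro t ht
    rw [hsum, expsum_eq_eval P hPdeg M t, abs_mul, abs_of_pos hc0]
    refine mul_le_of_le_one_right hc0.le ?_
    rw [hP]
    exact abs_eval_chebAff_le_one r M (by rw [hr_def]; exact abs_expm1_ratio_le_one hl₀ hM0 ht)
  · -- attained at `t = l₀`
    rw [hsum, expsum_eq_eval P hPdeg M l₀, show exp (l₀ / M) = 1 + r by rw [hr_def]; ring, hP,
      eval_chebAff_one_add hr0.ne', mul_one]
  · -- the first moment, exactly
    rw [habs_mom]
  · -- the first moment, from below
    rw [habs_mom, div_eq_mul_inv (2 / Λ) r, mul_comm]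
    exact mul_le_mul_of_nonneg_left hinv_r hc0.le


/-! ## §5 Two purely atomic probability laws on the grid `{j∕M} ⊂ [0, 1]` from a signed weight vector -/

/-- Integration against a finite combination of Dirac masses. [folklore] -/
theorem integral_sum_smul_dirac (c : ℕ → ℝ) (hc : ∀ j, 0 ≤ c j) (x : ℕ → ℝ) (D : ℕ) (g : ℝ → ℝ) :
    ∫ y, g y ∂(∑ j ∈ range D, ENNReal.ofReal (c j) • Measure.dirac (x j)) = ∑ j ∈ range D, c j * g (x j) := by
  rw [integral_finsetSum_measure]
  · refine sum_congr rfl fun j _ => ?_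
    rw [integral_smul_measure, integral_dirac, ENNReal.toReal_ofReal (hc j), smul_eq_mul]
  · intro j _
    exact ((integrable_const (g (x j))).congr (ae_eq_dirac g).symm).smul_measure ENNReal.ofReal_ne_top

/-- The mass a finite combination of Dirac masses gives to a set containing all its atoms. [folklore] -/
theorem sum_smul_dirac_apply_of_mem (c : ℕ → ℝ) (hc : ∀ j, 0 ≤ c j) (x : ℕ → ℝ) {D : ℕ} {s : Set ℝ}
    (hs : ∀ j ∈ range D, x j ∈ s) :
    (∑ j ∈ range D, ENNReal.ofReal (c j) • Measure.dirac (x j)) s = ENNReal.ofReal (∑ j ∈ range D, c j) := by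
  rw [Measure.finsetSum_apply, ENNReal.ofReal_sum_of_nonneg fun j _ => hc j]
  refine sum_congr rfl fun j hj => ?_
  rw [Measure.smul_apply, smul_eq_mul, Measure.dirac_apply_of_mem (hs j hj), mul_one]

/-- **TWO LAWS FROM ONE SIGNED WEIGHT VECTOR.**  A real weight vector `w` on `{0, …, M}` with `∑ w_j = 0` and `∑ |w_j| = 2`
is the difference `ν − μ` of two PROBABILITY laws on the grid `{j∕M} ⊂ [0, 1]` (`ν = ∑ w_j⁺ δ_{j∕M}`, `μ = ∑ w_j⁻ δ_{j∕M}`,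
`w^± = (|w| ± w)∕2`, each of total mass `1`): for EVERY `g`, `∫ g dν − ∫ g dμ = ∑_j w_j g(j∕M)`. [folklore] -/
theorem exists_lawPair_of_weights {M : ℕ} (w : ℕ → ℝ)
    (h0 : ∑ j ∈ range (M + 1), w j = 0) (h2 : ∑ j ∈ range (M + 1), |w j| = 2) :
    ∃ μ ν : Measure ℝ, IsProbabilityMeasure μ ∧ IsProbabilityMeasure ν ∧
      μ (Set.Icc 0 1)ᶜ = 0 ∧ ν (Set.Icc 0 1)ᶜ = 0 ∧
      ∀ g : ℝ → ℝ, ∫ x, g x ∂ν - ∫ x, g x ∂μ = ∑ j ∈ range (M + 1), w j * g (j / M) := by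
  have hp0 : ∀ j, 0 ≤ (|w j| + w j) / 2 := fun j => by
    have := neg_abs_le (w j)
    linarith
  have hn0 : ∀ j, 0 ≤ (|w j| - w j) / 2 := fun j => by
    have := le_abs_self (w j)
    linarith
  have hp1 : ∑ j ∈ range (M + 1), (|w j| + w j) / 2 = 1 := by
    rw [← sum_div, sum_add_distrib, h2, h0]
    norm_num
  have hn1 : ∑ j ∈ range (M + 1), (|w j| - w j) / 2 = 1 := by
    rw [← sum_div, sum_sub_distrib, h2, h0]
    norm_num
  have hgrid : ∀ j ∈ range (M + 1), ((j : ℝ) / M) ∈ Set.Icc (0 : ℝ) 1 := fun j hj =>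
    ⟨by positivity, div_le_one_of_le₀ (by exact_mod_cast Nat.lt_succ_iff.mp (mem_range.mp hj)) (Nat.cast_nonneg M)⟩
  set μ : Measure ℝ := ∑ j ∈ range (M + 1), ENNReal.ofReal ((|w j| - w j) / 2) • Measure.dirac ((j : ℝ) / M) with hμ
  set ν : Measure ℝ := ∑ j ∈ range (M + 1), ENNReal.ofReal ((|w j| + w j) / 2) • Measure.dirac ((j : ℝ) / M) with hν
  have iμ : IsProbabilityMeasure μ :=
    ⟨by rw [hμ, sum_smul_dirac_apply_of_mem _ hn0 _ fun j _ => Set.mem_univ _, hn1, ENNReal.ofReal_one]⟩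
  have iν : IsProbabilityMeasure ν :=
    ⟨by rw [hν, sum_smul_dirac_apply_of_mem _ hp0 _ fun j _ => Set.mem_univ _, hp1, ENNReal.ofReal_one]⟩
  refine ⟨μ, ν, iμ, iν, ?_, ?_, ?_⟩
  · rw [prob_compl_eq_zero_iff measurableSet_Icc, hμ, sum_smul_dirac_apply_of_mem _ hn0 _ hgrid, hn1,
      ENNReal.ofReal_one]
  · rw [prob_compl_eq_zero_iff measurableSet_Icc, hν, sum_smul_dirac_apply_of_mem _ hp0 _ hgrid, hp1,
      ENNReal.ofReal_one]
  · intro g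
    rw [hμ, hν, integral_sum_smul_dirac _ hp0, integral_sum_smul_dirac _ hn0, ← sum_sub_distrib]
    refine sum_congr rfl fun j _ => ?_
    ring

/-! ## §6 THE TWO LAWS: mgf's `ε`-close on the window, means `≥ (M·e^{−l₀}∕l₀)·ε` apart -/

/-- **MGF's CLOSE ON A WINDOW, MEANS FAR (explicit family).**  For every window `0 < l₀` and every odd `M` there are two
PROBABILITY laws `μ, ν` on `[0, 1]` (so the identity is an observable bounded by `1` under both) and `ε > 0` with
`2·(1 + 4M∕l₀)^{−M} ≤ ε ≤ 4·(l₀e^{l₀}∕(2M))^M` such that the moment generating functions are `ε`-close on the whole window,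
`|mgf_ν(t) − mgf_μ(t)| ≤ ε` for `|t| ≤ l₀` (with EQUALITY `mgf_ν(l₀) − mgf_μ(l₀) = ε`), while the means differ by EXACTLY
`ε∕(e^{l₀∕M} − 1) ≥ (M·e^{−l₀}∕l₀)·ε`.  (§4's weights `w` realised as `ν − μ` by §5.) [folklore] -/
theorem exists_mgf_close_means_far {l₀ : ℝ} (hl₀ : 0 < l₀) {M : ℕ} (hM : Odd M) :
    ∃ μ ν : Measure ℝ, IsProbabilityMeasure μ ∧ IsProbabilityMeasure ν ∧
      μ (Set.Icc 0 1)ᶜ = 0 ∧ ν (Set.Icc 0 1)ᶜ = 0 ∧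
      ∃ ε : ℝ, 0 < ε ∧ 2 / (1 + 4 * M / l₀) ^ M ≤ ε ∧ ε ≤ 4 * (l₀ * exp l₀ / (2 * M)) ^ M ∧
        (∀ t : ℝ, |t| ≤ l₀ → |mgf id ν t - mgf id μ t| ≤ ε) ∧
        mgf id ν l₀ - mgf id μ l₀ = ε ∧
        |∫ x, x ∂ν - ∫ x, x ∂μ| = ε / (exp (l₀ / M) - 1) ∧
        M * exp (-l₀) / l₀ * ε ≤ |∫ x, x ∂ν - ∫ x, x ∂μ| := by
  obtain ⟨w, ε, hε, -, h0, h2, hlo, hhi, hwin, hat, hmom, hmom'⟩ := exists_expsum_witness hl₀ hM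
  obtain ⟨μ, ν, iμ, iν, hμ, hν, hg⟩ := exists_lawPair_of_weights w h0 h2
  have hmgf : ∀ t : ℝ, mgf id ν t - mgf id μ t = ∑ j ∈ range (M + 1), w j * exp (t * j / M) := by
    intro t
    simp only [mgf, id]
    rw [hg fun x => exp (t * x)]
    refine sum_congr rfl fun j _ => ?_
    rw [mul_div_assoc]
  have hmean : ∫ x, x ∂ν - ∫ x, x ∂μ = ∑ j ∈ range (M + 1), w j * (j / M) := hg fun x => x
  refine ⟨μ, ν, iμ, iν, hμ, hν, ε, hε, hlo, hhi, fun t ht => ?_, ?_, ?_, ?_⟩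
  · rw [hmgf]
    exact hwin t ht
  · rw [hmgf]
    exact hat
  · rw [hmean]
    exact hmom
  · rw [hmean]
    exact hmom'

/-- Logarithms of numbers `≥ m > 0` are `m⁻¹`-Lipschitz. [folklore] -/
theorem abs_log_sub_log_le {a b m : ℝ} (hm : 0 < m) (ha : m ≤ a) (hb : m ≤ b) : |log a - log b| ≤ |a - b| / m := by
  have ha0 : 0 < a := hm.trans_le ha
  have hb0 : 0 < b := hm.trans_le hb
  rw [abs_le]
  constructor
  · -- `log b − log a ≤ (b − a)/a ≤ |a − b|/m`
    have h1 : log b - log a ≤ (b - a) / a := by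
      rw [← log_div hb0.ne' ha0.ne', ← div_sub_one ha0.ne']
      exact log_le_sub_one_of_pos (div_pos hb0 ha0)
    have h2 : (b - a) / a ≤ |a - b| / m := by
      rw [div_le_div_iff₀ ha0 hm]
      calc (b - a) * m ≤ |a - b| * m := by
            refine mul_le_mul_of_nonneg_right ?_ hm.le
            rw [abs_sub_comm]
            exact le_abs_self _
        _ ≤ |a - b| * a := mul_le_mul_of_nonneg_left ha (abs_nonneg _)
    linarith
  · have h1 : log a - log b ≤ (a - b) / b := by
      rw [← log_div ha0.ne' hb0.ne', ← div_sub_one hb0.ne']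
      exact log_le_sub_one_of_pos (div_pos ha0 hb0)
    have h2 : (a - b) / b ≤ |a - b| / m := by
      rw [div_le_div_iff₀ hb0 hm]
      calc (a - b) * m ≤ |a - b| * m := mul_le_mul_of_nonneg_right (le_abs_self _) hm.le
        _ ≤ |a - b| * b := mul_le_mul_of_nonneg_left hb (abs_nonneg _)
    linarith

/-- A law on `[0, 1]`: the identity is bounded by `1` a.e. [folklore] -/
theorem ae_abs_le_one_of_Icc {μ : Measure ℝ} (hμ : μ (Set.Icc 0 1)ᶜ = 0) : ∀ᵐ x ∂μ, |id x| ≤ (1 : ℝ) := by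
  have h : ∀ᵐ x ∂μ, x ∈ Set.Icc (0 : ℝ) 1 := by
    rw [ae_iff]
    simpa only [Set.mem_Icc, Set.compl_def] using hμ
  exact h.mono fun x hx => by rw [id, abs_le]; exact ⟨by linarith [hx.1], hx.2⟩

/-- For a probability law on `[0, 1]`, `mgf(t) ≥ e^{−l₀}` on `|t| ≤ l₀`. [folklore] -/
theorem exp_neg_le_mgf_of_Icc {μ : Measure ℝ} [IsProbabilityMeasure μ] (hμ : μ (Set.Icc 0 1)ᶜ = 0) {l₀ t : ℝ}
    (ht : |t| ≤ l₀) : exp (-l₀) ≤ mgf id μ t := by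
  have h := Literature.MathematicalPhysics.QuantumFieldTheory.Balaban1983to89.T4GenFunBounds.exp_neg_le_mgf_of_abs_le
    aemeasurable_id (ae_abs_le_one_of_Icc hμ) t
  rw [probReal_univ, one_mul, mul_one] at h
  exact (exp_le_exp.mpr (neg_le_neg ht)).trans h

/-- **… HENCE CGF's `e^{l₀}·ε`-CLOSE ON THE WINDOW** (the currency of N19's DECL target `T4CauchySum.MatchingModConstants` ∕
`Spine.NE7.Target` is a bound on differences of LOGARITHMS of dressed partition functions, i.e. of cgf's): the same pair has
`|cgf_ν(t) − cgf_μ(t)| ≤ e^{l₀}·ε` on `|t| ≤ l₀` (mgf's `≥ e^{−l₀}` there) and means `≥ (M·e^{−2l₀}∕l₀)·(e^{l₀}ε)` apart. [folklore] -/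
theorem exists_cgf_close_means_far {l₀ : ℝ} (hl₀ : 0 < l₀) {M : ℕ} (hM : Odd M) :
    ∃ μ ν : Measure ℝ, IsProbabilityMeasure μ ∧ IsProbabilityMeasure ν ∧
      μ (Set.Icc 0 1)ᶜ = 0 ∧ ν (Set.Icc 0 1)ᶜ = 0 ∧
      ∃ ε : ℝ, 0 < ε ∧ exp l₀ * (2 / (1 + 4 * M / l₀) ^ M) ≤ ε ∧ ε ≤ exp l₀ * (4 * (l₀ * exp l₀ / (2 * M)) ^ M) ∧
        (∀ t : ℝ, |t| ≤ l₀ → |cgf id ν t - cgf id μ t| ≤ ε) ∧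
        M * exp (-2 * l₀) / l₀ * ε ≤ |∫ x, x ∂ν - ∫ x, x ∂μ| := by
  obtain ⟨μ, ν, iμ, iν, hμ, hν, ε, hε, hlo, hhi, hwin, -, -, hmom⟩ := exists_mgf_close_means_far hl₀ hM
  refine ⟨μ, ν, iμ, iν, hμ, hν, exp l₀ * ε, by positivity, mul_le_mul_of_nonneg_left hlo (exp_pos _).le,
    mul_le_mul_of_nonneg_left hhi (exp_pos _).le, fun t ht => ?_, ?_⟩
  · have hm : 0 < exp (-l₀) := exp_pos _
    calc |cgf id ν t - cgf id μ t| ≤ |mgf id ν t - mgf id μ t| / exp (-l₀) :=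
          abs_log_sub_log_le hm (exp_neg_le_mgf_of_Icc hν ht) (exp_neg_le_mgf_of_Icc hμ ht)
      _ ≤ ε / exp (-l₀) := div_le_div_of_nonneg_right (hwin t ht) hm.le
      _ = exp l₀ * ε := by rw [Real.exp_neg, div_inv_eq_mul, mul_comm]
  · calc M * exp (-2 * l₀) / l₀ * (exp l₀ * ε) = M * exp (-l₀) / l₀ * ε := by
          have : exp (-2 * l₀) * exp l₀ = exp (-l₀) := by rw [← Real.exp_add]; ring_nf
          calc M * exp (-2 * l₀) / l₀ * (exp l₀ * ε) = M * (exp (-2 * l₀) * exp l₀) / l₀ * ε := by ring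
            _ = M * exp (-l₀) / l₀ * ε := by rw [this]
      _ ≤ |∫ x, x ∂ν - ∫ x, x ∂μ| := hmom

/-- **NO LINEAR PRICE (mgf form).**  For every window `0 < l₀` and every constant `C` there are two probability laws on `[0, 1]`
and `ε ≥ 0` with mgf's `ε`-close on `|t| ≤ l₀` but `|E_ν − E_μ| > C·ε` (so necessarily `ε < 1∕C`: means of laws on `[0,1]` differ by
at most `1` — the failure is in the SMALL-`ε` regime): no estimate `|E_ν − E_μ| ≤ C(l₀)·sup_{|t|≤l₀}|mgf_ν − mgf_μ|` holds on the class of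
`[0,1]`-valued (a fortiori `[−B,B]`-valued) observables. [folklore] -/
theorem no_linear_price_mgf {l₀ : ℝ} (hl₀ : 0 < l₀) (C : ℝ) :
    ∃ μ ν : Measure ℝ, IsProbabilityMeasure μ ∧ IsProbabilityMeasure ν ∧
      μ (Set.Icc 0 1)ᶜ = 0 ∧ ν (Set.Icc 0 1)ᶜ = 0 ∧
      ∃ ε : ℝ, 0 ≤ ε ∧ (∀ t : ℝ, |t| ≤ l₀ → |mgf id ν t - mgf id μ t| ≤ ε) ∧
        C * ε < |∫ x, x ∂ν - ∫ x, x ∂μ| := by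
  -- an odd `M` with `C < M·e^{−l₀}/l₀`
  obtain ⟨k, hk⟩ := exists_nat_gt (C * l₀ * exp l₀)
  obtain ⟨μ, ν, iμ, iν, hμ, hν, ε, hε, -, -, hwin, -, -, hmom⟩ :=
    exists_mgf_close_means_far hl₀ (M := 2 * k + 1) (odd_two_mul_add_one k)
  refine ⟨μ, ν, iμ, iν, hμ, hν, ε, hε.le, hwin, lt_of_lt_of_le ?_ hmom⟩
  refine mul_lt_mul_of_pos_right ?_ hε
  have h1 : C * l₀ < k * exp (-l₀) := by
    have := mul_lt_mul_of_pos_right hk (exp_pos (-l₀))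
    rwa [mul_assoc, ← Real.exp_add, add_neg_cancel, Real.exp_zero, mul_one] at this
  have h2 : (k : ℝ) * exp (-l₀) ≤ ((2 * k + 1 : ℕ) : ℝ) * exp (-l₀) := by
    gcongr
    linarith
  rw [lt_div_iff₀ hl₀]
  exact h1.trans_le h2

/-- **NO LINEAR PRICE (cgf form)** — the currency of N19's DECL target: for every window `0 < l₀` and every `C` there are two
probability laws on `[0, 1]` and `ε ≥ 0` with CGF's `ε`-close on `|t| ≤ l₀` but `|E_ν − E_μ| > C·ε`. [folklore] -/
theorem no_linear_price_cgf {l₀ : ℝ} (hl₀ : 0 < l₀) (C : ℝ) :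
    ∃ μ ν : Measure ℝ, IsProbabilityMeasure μ ∧ IsProbabilityMeasure ν ∧
      μ (Set.Icc 0 1)ᶜ = 0 ∧ ν (Set.Icc 0 1)ᶜ = 0 ∧
      ∃ ε : ℝ, 0 ≤ ε ∧ (∀ t : ℝ, |t| ≤ l₀ → |cgf id ν t - cgf id μ t| ≤ ε) ∧
        C * ε < |∫ x, x ∂ν - ∫ x, x ∂μ| := by
  obtain ⟨k, hk⟩ := exists_nat_gt (C * l₀ * exp (2 * l₀))
  obtain ⟨μ, ν, iμ, iν, hμ, hν, ε, hε, -, -, hwin, hmom⟩ :=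
    exists_cgf_close_means_far hl₀ (M := 2 * k + 1) (odd_two_mul_add_one k)
  refine ⟨μ, ν, iμ, iν, hμ, hν, ε, hε.le, hwin, lt_of_lt_of_le ?_ hmom⟩
  refine mul_lt_mul_of_pos_right ?_ hε
  have h1 : C * l₀ < k * exp (-2 * l₀) := by
    have := mul_lt_mul_of_pos_right hk (exp_pos (-2 * l₀))
    rwa [mul_assoc, ← Real.exp_add, show 2 * l₀ + -2 * l₀ = 0 by ring, Real.exp_zero, mul_one] at this
  have h2 : (k : ℝ) * exp (-2 * l₀) ≤ ((2 * k + 1 : ℕ) : ℝ) * exp (-2 * l₀) := by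
    gcongr
    linarith
  rw [lt_div_iff₀ hl₀]
  exact h1.trans_le h2

end Summit.QuantumFields.YangMills.Theorems.BalabanUVNodesN19NoLinearPrice

end
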